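import Mathlib.Tactic.Group
import Mathlib.Data.Finset.Prod
import Literature.Combinatorics.Additive.TPPGroupAlgebra
import Literature.Computability.AlgebraicComplexity.CohnUmansTPP
import Summits.MatrixMultiplication.MatrixMultiplication.Theorems.HyperoctahedralThreshold.Negative.HostedTPPSATTransfer

/-!
# K4 bound, part 1 (injections): towards `[G : Z(G)] = 4 ⇒ 4·|S||T||U| ≤ 5·|G|` for every TPP triple

ω-census, family (b3) (single TPP triples in small groups); tpp lane (sr-tpp-search-g16, restyled g19).
Framing: lottery ticket; floor = certified bounds/negative ranges.

Abstract hypotheses on a group `G` and an element `z` (all satisfied when `[G : Z(G)] = 4`, i.e. `G/Z ≅ C₂²`,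
`G' = {1, z}`; e.g. `D8 × A`, `Q8 × A` with `A` abelian):
* `hzc : ∀ g, g * z = z * g` (central), `hzz : z * z = 1`, `hz1 : z ≠ 1`;
* `hcomm : ∀ g h, g*h*g⁻¹*h⁻¹ = 1 ∨ g*h*g⁻¹*h⁻¹ = z`  (`G' ⊆ {1, z}`);
* `hK4 : ∀ a b c, a*b*c = z → IsC a ∨ IsC b ∨ IsC c ∨ a*b*a⁻¹*b⁻¹ = z` (`IsC g` = `g` is central): a
  factorisation `a b c = z` with no central factor puts the three factors into the three distinct non-trivial
  cosets of `Z`, which pairwise do not commute.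

This file: the TPP permutation lemmas, the elementary algebra of a central involution, the three "two-pattern"
injections `inj12 / inj13 / inj23` (two collisions `w(p,q) = z` sharing two coordinates and each having a central
quotient coincide), the central-quotient lemma (`central_quotient`: in every collision some coordinate quotient is
central), and the finite bookkeeping objects (`Pts`, `Coll`, `Fib`, `Rel`) used by the counting in
`K4Bound.lean`, where the main theorem `K4_bound : 4 |S||T||U| ≤ 5 |G|` and the corollaries for `D8 × A`, `Q8 × A`
(frontier cell AG-184-3 of the census: no `⟨9,8,4⟩` in the K4 groups of order 184) are proved.
Informal proof: HOME/sr-tpp-search-g16/K4-THEORY.md §MAIN THEOREM (tpp lane).  This is new mathematics of the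
cell (elementary; not a published statement): it lives under `Summits/`, not `Literature/`.
-/

open Finset
open Literature.Combinatorics.Additive
open Literature.Computability.AlgebraicComplexity
-- dedup (gate `dedup.landed`): reuse the landed `tpp_reverse` instead of restating it
open Summit.MatrixMultiplication.MatrixMultiplication.Theorems.HyperoctahedralThreshold.Negative (tpp_reverse)

namespace Summit.MatrixMultiplication.OmegaCensus.K4Bound

variable {G : Type*} [Group G]

variable {G : Type*} [Group G]

/-! ### Permutations of a TPP triple -/

-- `(S,T,U) ↦ (U,T,S)` (`tpp_reverse`): the landed
-- `Summit.MatrixMultiplication.MatrixMultiplication.Theorems.HyperoctahedralThreshold.Negative.tpp_reverse` (opened above).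

/-- `(S,T,U) ↦ (T,S,U)`. [folklore] -/
theorem tpp_swap12 {S T U : Finset G} (h : TripleProductProperty S T U) :
    TripleProductProperty T S U := tpp_reverse h.rotate.rotate

/-- `(S,T,U) ↦ (S,U,T)`. [folklore] -/
theorem tpp_swap23 {S T U : Finset G} (h : TripleProductProperty S T U) :
    TripleProductProperty S U T := tpp_reverse h.rotate

/-- `(S,T,U) ↦ (U,S,T)`. [folklore] -/
theorem tpp_rot2 {S T U : Finset G} (h : TripleProductProperty S T U) :
    TripleProductProperty U S T := h.rotate.rotate

/-! ### Elementary algebra with a central involution `z` -/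

section Alg
variable (z : G)

/-- `g` is central. [folklore] -/
def IsC (g : G) : Prop := ∀ x : G, x * g = g * x

/-- `1` is central. [folklore] -/
theorem isC_one : IsC (1 : G) := fun x => by simp

variable {z}

/-- inverses of central elements are central. [folklore] -/
theorem isC_inv {g : G} (hg : IsC g) : IsC g⁻¹ := by
  intro x
  have := hg (x)
  calc x * g⁻¹ = g⁻¹ * (g * x) * g⁻¹ := by group
    _ = g⁻¹ * (x * g) * g⁻¹ := by rw [this]
    _ = g⁻¹ * x := by group

/-- products of central elements are central. [folklore] -/
theorem isC_mul {g h : G} (hg : IsC g) (hh : IsC h) : IsC (g * h) := by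
  intro x
  calc x * (g * h) = (x * g) * h := by group
    _ = g * x * h := by rw [hg x]
    _ = g * (x * h) := by group
    _ = g * (h * x) := by rw [hh x]
    _ = g * h * x := by group

/-- conjugation by a central `z` is trivial. [folklore] -/
theorem conj_z (hzc : ∀ g : G, g * z = z * g) (x : G) : z⁻¹ * x * z = x := by
  rw [mul_assoc, hzc x, ← mul_assoc, inv_mul_cancel, one_mul]

/-- an involution is its own inverse. [folklore] -/
theorem zinv (hzz : z * z = 1) : z⁻¹ = z := inv_eq_of_mul_eq_one_right hzz

/-- Membership in `{1, z}`. [folklore] -/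
def M (z g : G) : Prop := g = 1 ∨ g = z

/-- `{1, z}` is closed under multiplication when `z² = 1`. [folklore] -/
theorem M_mul (hzz : z * z = 1) {a b : G} (ha : M z a) (hb : M z b) : M z (a * b) := by
  rcases ha with rfl | rfl <;> rcases hb with rfl | rfl
  · left; simp
  · right; simp
  · right; simp
  · left; exact hzz

/-- The word of the triple product property versus the "product word":
`s s'⁻¹ t t'⁻¹ u u'⁻¹ = (stu (s't'u')⁻¹) · [s', t'u'u⁻¹t⁻¹] · [t', u'u⁻¹]` (free-group identity). [folklore] -/
theorem word_eq (s t u s' t' u' : G) :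
    s * s'⁻¹ * (t * t'⁻¹) * (u * u'⁻¹)
      = (s * t * u * (s' * t' * u')⁻¹)
        * (s' * (t' * u' * u⁻¹ * t⁻¹) * s'⁻¹ * (t' * u' * u⁻¹ * t⁻¹)⁻¹)
        * (t' * (u' * u⁻¹) * t'⁻¹ * (u' * u⁻¹)⁻¹) := by
  group

/-- If `stu` and `s't'u'` lie in one `⟨z⟩`-coset then the TPP word lies in `{1, z}`. [folklore] -/
theorem M_word (hzc : ∀ g : G, g * z = z * g) (hzz : z * z = 1)
    (hcomm : ∀ g h : G, g * h * g⁻¹ * h⁻¹ = 1 ∨ g * h * g⁻¹ * h⁻¹ = z)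
    {s t u s' t' u' : G} (hrel : s' * t' * u' = s * t * u ∨ s' * t' * u' = s * t * u * z) :
    M z (s * s'⁻¹ * (t * t'⁻¹) * (u * u'⁻¹)) := by
  rw [word_eq]
  refine M_mul hzz (M_mul hzz ?_ (hcomm _ _)) (hcomm _ _)
  rcases hrel with h | h
  · left; rw [h]; group
  · right; rw [h]
    calc s * t * u * (s * t * u * z)⁻¹ = (s * t * u) * z⁻¹ * (s * t * u)⁻¹ := by group
      _ = (s * t * u) * z * (s * t * u)⁻¹ := by rw [zinv hzz]
      _ = z * (s * t * u) * (s * t * u)⁻¹ := by rw [hzc (s * t * u)]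
      _ = z := by group

end Alg

/-! ### The three two-pattern injections (CC2) and the central-quotient lemma -/

section Inj
variable {z : G} {S T U : Finset G}

/-- CC2, map `(s', t', u)`: two collisions sharing `s', t', u`, each with central `S`- or `T`-quotient, coincide. [folklore] -/
theorem inj12 (hTPP : TripleProductProperty S T U) (hzc : ∀ g : G, g * z = z * g)
    {s₁ t₁ u₁' s₂ t₂ u₂' s' t' u : G}
    (hs₁ : s₁ ∈ S) (hs₂ : s₂ ∈ S) (ht₁ : t₁ ∈ T) (ht₂ : t₂ ∈ T) (hu₁ : u₁' ∈ U) (hu₂ : u₂' ∈ U)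
    (h1 : s₁ * s'⁻¹ * (t₁ * t'⁻¹) * (u * u₁'⁻¹) = z)
    (h2 : s₂ * s'⁻¹ * (t₂ * t'⁻¹) * (u * u₂'⁻¹) = z)
    (hc1 : IsC (s₁ * s'⁻¹) ∨ IsC (t₁ * t'⁻¹)) (hc2 : IsC (s₂ * s'⁻¹) ∨ IsC (t₂ * t'⁻¹)) :
    s₁ = s₂ ∧ t₁ = t₂ ∧ u₁' = u₂' := by
  have e1 : u * u₁'⁻¹ = (s₁ * s'⁻¹ * (t₁ * t'⁻¹))⁻¹ * z := by
    calc u * u₁'⁻¹ = (s₁ * s'⁻¹ * (t₁ * t'⁻¹))⁻¹ * (s₁ * s'⁻¹ * (t₁ * t'⁻¹) * (u * u₁'⁻¹)) := by group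
      _ = _ := by rw [h1]
  have e2 : u * u₂'⁻¹ = (s₂ * s'⁻¹ * (t₂ * t'⁻¹))⁻¹ * z := by
    calc u * u₂'⁻¹ = (s₂ * s'⁻¹ * (t₂ * t'⁻¹))⁻¹ * (s₂ * s'⁻¹ * (t₂ * t'⁻¹) * (u * u₂'⁻¹)) := by group
      _ = _ := by rw [h2]
  have key : u₁' * u₂'⁻¹ = s₁ * s'⁻¹ * (t₁ * t₂⁻¹) * (s' * s₂⁻¹) := by
    calc u₁' * u₂'⁻¹ = (u * u₁'⁻¹)⁻¹ * (u * u₂'⁻¹) := by group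
      _ = ((s₁ * s'⁻¹ * (t₁ * t'⁻¹))⁻¹ * z)⁻¹ * ((s₂ * s'⁻¹ * (t₂ * t'⁻¹))⁻¹ * z) := by rw [e1, e2]
      _ = z⁻¹ * (s₁ * s'⁻¹ * (t₁ * t₂⁻¹) * (s' * s₂⁻¹)) * z := by group
      _ = _ := conj_z hzc _
  -- case (a)/(c): the S₁-quotient commutes past `t₁ t₂⁻¹`
  have caseA : s₁ * s'⁻¹ * (t₁ * t₂⁻¹) = t₁ * t₂⁻¹ * (s₁ * s'⁻¹) → s₁ = s₂ ∧ t₁ = t₂ ∧ u₁' = u₂' := by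
    intro hsw
    rw [hsw] at key
    have rel : t₁ * t₂⁻¹ * (s₁ * s₂⁻¹) * (u₂' * u₁'⁻¹) = 1 := by
      calc t₁ * t₂⁻¹ * (s₁ * s₂⁻¹) * (u₂' * u₁'⁻¹)
          = t₁ * t₂⁻¹ * (s₁ * s'⁻¹) * (s' * s₂⁻¹) * (u₁' * u₂'⁻¹)⁻¹ := by group
        _ = 1 := by rw [← key]; group
    obtain ⟨ht, hs, hu⟩ := tpp_swap12 hTPP t₁ ht₁ t₂ ht₂ s₁ hs₁ s₂ hs₂ u₂' hu₂ u₁' hu₁ rel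
    exact ⟨hs, ht, hu.symm⟩
  rcases hc1 with ha | h1c
  · exact caseA (ha (t₁ * t₂⁻¹)).symm
  rcases hc2 with hb | h2c
  · -- case (b): `s' s₂⁻¹` is central
    have hb' : IsC (s' * s₂⁻¹) := by
      have := isC_inv hb; rwa [show (s₂ * s'⁻¹)⁻¹ = s' * s₂⁻¹ by group] at this
    rw [mul_assoc (s₁ * s'⁻¹), hb' (t₁ * t₂⁻¹)] at key
    have rel : s₁ * s₂⁻¹ * (t₁ * t₂⁻¹) * (u₂' * u₁'⁻¹) = 1 := by
      calc s₁ * s₂⁻¹ * (t₁ * t₂⁻¹) * (u₂' * u₁'⁻¹)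
          = s₁ * s'⁻¹ * (s' * s₂⁻¹ * (t₁ * t₂⁻¹)) * (u₁' * u₂'⁻¹)⁻¹ := by group
        _ = 1 := by rw [← key]; group
    obtain ⟨hs, ht, hu⟩ := hTPP s₁ hs₁ s₂ hs₂ t₁ ht₁ t₂ ht₂ u₂' hu₂ u₁' hu₁ rel
    exact ⟨hs, ht, hu.symm⟩
  · -- case (c): `t₁ t₂⁻¹` is central
    have hc : IsC (t₁ * t₂⁻¹) := by
      have := isC_mul h1c (isC_inv h2c)
      rwa [show t₁ * t'⁻¹ * (t₂ * t'⁻¹)⁻¹ = t₁ * t₂⁻¹ by group] at this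
    exact caseA (hc (s₁ * s'⁻¹))

/-- CC2, map `(s', t, u')`: central `S`- or `U`-quotient. [folklore] -/
theorem inj13 (hTPP : TripleProductProperty S T U) (hzc : ∀ g : G, g * z = z * g)
    {s₁ t₁' u₁ s₂ t₂' u₂ s' t u' : G}
    (hs₁ : s₁ ∈ S) (hs₂ : s₂ ∈ S) (ht₁ : t₁' ∈ T) (ht₂ : t₂' ∈ T) (hu₁ : u₁ ∈ U) (hu₂ : u₂ ∈ U)
    (h1 : s₁ * s'⁻¹ * (t * t₁'⁻¹) * (u₁ * u'⁻¹) = z)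
    (h2 : s₂ * s'⁻¹ * (t * t₂'⁻¹) * (u₂ * u'⁻¹) = z)
    (hc1 : IsC (s₁ * s'⁻¹) ∨ IsC (u₁ * u'⁻¹)) (hc2 : IsC (s₂ * s'⁻¹) ∨ IsC (u₂ * u'⁻¹)) :
    s₁ = s₂ ∧ t₁' = t₂' ∧ u₁ = u₂ := by
  have e1 : t * t₁'⁻¹ = (s₁ * s'⁻¹)⁻¹ * z * (u₁ * u'⁻¹)⁻¹ := by
    calc t * t₁'⁻¹ = (s₁ * s'⁻¹)⁻¹ * (s₁ * s'⁻¹ * (t * t₁'⁻¹) * (u₁ * u'⁻¹)) * (u₁ * u'⁻¹)⁻¹ := by group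
      _ = _ := by rw [h1]
  have e2 : t * t₂'⁻¹ = (s₂ * s'⁻¹)⁻¹ * z * (u₂ * u'⁻¹)⁻¹ := by
    calc t * t₂'⁻¹ = (s₂ * s'⁻¹)⁻¹ * (s₂ * s'⁻¹ * (t * t₂'⁻¹) * (u₂ * u'⁻¹)) * (u₂ * u'⁻¹)⁻¹ := by group
      _ = _ := by rw [h2]
  have key : t₁' * t₂'⁻¹ = u₁ * u'⁻¹ * (s₁ * s₂⁻¹) * (u' * u₂⁻¹) := by
    calc t₁' * t₂'⁻¹ = (t * t₁'⁻¹)⁻¹ * (t * t₂'⁻¹) := by group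
      _ = ((s₁ * s'⁻¹)⁻¹ * z * (u₁ * u'⁻¹)⁻¹)⁻¹ * ((s₂ * s'⁻¹)⁻¹ * z * (u₂ * u'⁻¹)⁻¹) := by rw [e1, e2]
      _ = u₁ * u'⁻¹ * (z⁻¹ * (s₁ * s₂⁻¹) * z) * (u' * u₂⁻¹) := by group
      _ = _ := by rw [conj_z hzc]
  have caseA : u₁ * u'⁻¹ * (s₁ * s₂⁻¹) = s₁ * s₂⁻¹ * (u₁ * u'⁻¹) → s₁ = s₂ ∧ t₁' = t₂' ∧ u₁ = u₂ := by
    intro hsw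
    rw [hsw] at key
    have rel : s₁ * s₂⁻¹ * (u₁ * u₂⁻¹) * (t₂' * t₁'⁻¹) = 1 := by
      calc s₁ * s₂⁻¹ * (u₁ * u₂⁻¹) * (t₂' * t₁'⁻¹)
          = s₁ * s₂⁻¹ * (u₁ * u'⁻¹) * (u' * u₂⁻¹) * (t₁' * t₂'⁻¹)⁻¹ := by group
        _ = 1 := by rw [← key]; group
    obtain ⟨hs, hu, ht⟩ := tpp_swap23 hTPP s₁ hs₁ s₂ hs₂ u₁ hu₁ u₂ hu₂ t₂' ht₂ t₁' ht₁ rel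
    exact ⟨hs, ht.symm, hu⟩
  rcases hc1 with h1s | ha
  · rcases hc2 with h2s | hb
    · -- both S-quotients central ⇒ `s₁ s₂⁻¹` central
      have hc : IsC (s₁ * s₂⁻¹) := by
        have := isC_mul h1s (isC_inv h2s)
        rwa [show s₁ * s'⁻¹ * (s₂ * s'⁻¹)⁻¹ = s₁ * s₂⁻¹ by group] at this
      exact caseA (hc (u₁ * u'⁻¹))
    · -- `u' u₂⁻¹` central
      have hb' : IsC (u' * u₂⁻¹) := by
        have := isC_inv hb; rwa [show (u₂ * u'⁻¹)⁻¹ = u' * u₂⁻¹ by group] at this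
      rw [mul_assoc (u₁ * u'⁻¹), hb' (s₁ * s₂⁻¹)] at key
      have rel : u₁ * u₂⁻¹ * (s₁ * s₂⁻¹) * (t₂' * t₁'⁻¹) = 1 := by
        calc u₁ * u₂⁻¹ * (s₁ * s₂⁻¹) * (t₂' * t₁'⁻¹)
            = u₁ * u'⁻¹ * (u' * u₂⁻¹ * (s₁ * s₂⁻¹)) * (t₁' * t₂'⁻¹)⁻¹ := by group
          _ = 1 := by rw [← key]; group
      obtain ⟨hu, hs, ht⟩ := tpp_rot2 hTPP u₁ hu₁ u₂ hu₂ s₁ hs₁ s₂ hs₂ t₂' ht₂ t₁' ht₁ rel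
      exact ⟨hs, ht.symm, hu⟩
  · exact caseA (ha (s₁ * s₂⁻¹)).symm

/-- CC2, map `(s, t', u')`: central `T`- or `U`-quotient. [folklore] -/
theorem inj23 (hTPP : TripleProductProperty S T U)
    {s₁' t₁ u₁ s₂' t₂ u₂ s t' u' : G}
    (hs₁ : s₁' ∈ S) (hs₂ : s₂' ∈ S) (ht₁ : t₁ ∈ T) (ht₂ : t₂ ∈ T) (hu₁ : u₁ ∈ U) (hu₂ : u₂ ∈ U)
    (h1 : s * s₁'⁻¹ * (t₁ * t'⁻¹) * (u₁ * u'⁻¹) = z)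
    (h2 : s * s₂'⁻¹ * (t₂ * t'⁻¹) * (u₂ * u'⁻¹) = z)
    (hc1 : IsC (t₁ * t'⁻¹) ∨ IsC (u₁ * u'⁻¹)) (hc2 : IsC (t₂ * t'⁻¹) ∨ IsC (u₂ * u'⁻¹)) :
    s₁' = s₂' ∧ t₁ = t₂ ∧ u₁ = u₂ := by
  have e1 : s * s₁'⁻¹ = z * (u₁ * u'⁻¹)⁻¹ * (t₁ * t'⁻¹)⁻¹ := by
    calc s * s₁'⁻¹ = (s * s₁'⁻¹ * (t₁ * t'⁻¹) * (u₁ * u'⁻¹)) * (u₁ * u'⁻¹)⁻¹ * (t₁ * t'⁻¹)⁻¹ := by group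
      _ = _ := by rw [h1]
  have e2 : s * s₂'⁻¹ = z * (u₂ * u'⁻¹)⁻¹ * (t₂ * t'⁻¹)⁻¹ := by
    calc s * s₂'⁻¹ = (s * s₂'⁻¹ * (t₂ * t'⁻¹) * (u₂ * u'⁻¹)) * (u₂ * u'⁻¹)⁻¹ * (t₂ * t'⁻¹)⁻¹ := by group
      _ = _ := by rw [h2]
  have key : s₁' * s₂'⁻¹ = t₁ * t'⁻¹ * (u₁ * u₂⁻¹) * (t' * t₂⁻¹) := by
    calc s₁' * s₂'⁻¹ = (s * s₁'⁻¹)⁻¹ * (s * s₂'⁻¹) := by group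
      _ = (z * (u₁ * u'⁻¹)⁻¹ * (t₁ * t'⁻¹)⁻¹)⁻¹ * (z * (u₂ * u'⁻¹)⁻¹ * (t₂ * t'⁻¹)⁻¹) := by rw [e1, e2]
      _ = _ := by group
  have caseB : t₁ * t'⁻¹ * (u₁ * u₂⁻¹) * (t' * t₂⁻¹) = t₁ * t'⁻¹ * (t' * t₂⁻¹ * (u₁ * u₂⁻¹)) →
      s₁' = s₂' ∧ t₁ = t₂ ∧ u₁ = u₂ := by
    intro hsw
    rw [hsw] at key
    have rel : t₁ * t₂⁻¹ * (u₁ * u₂⁻¹) * (s₂' * s₁'⁻¹) = 1 := by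
      calc t₁ * t₂⁻¹ * (u₁ * u₂⁻¹) * (s₂' * s₁'⁻¹)
          = t₁ * t'⁻¹ * (t' * t₂⁻¹ * (u₁ * u₂⁻¹)) * (s₁' * s₂'⁻¹)⁻¹ := by group
        _ = 1 := by rw [← key]; group
    obtain ⟨ht, hu, hs⟩ := hTPP.rotate t₁ ht₁ t₂ ht₂ u₁ hu₁ u₂ hu₂ s₂' hs₂ s₁' hs₁ rel
    exact ⟨hs.symm, ht, hu⟩
  rcases hc1 with ha | h1u
  · -- `t₁ t'⁻¹` central
    rw [← ha (u₁ * u₂⁻¹)] at key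
    have rel : u₁ * u₂⁻¹ * (t₁ * t₂⁻¹) * (s₂' * s₁'⁻¹) = 1 := by
      calc u₁ * u₂⁻¹ * (t₁ * t₂⁻¹) * (s₂' * s₁'⁻¹)
          = u₁ * u₂⁻¹ * (t₁ * t'⁻¹) * (t' * t₂⁻¹) * (s₁' * s₂'⁻¹)⁻¹ := by group
        _ = 1 := by rw [← key]; group
    obtain ⟨hu, ht, hs⟩ := tpp_reverse hTPP u₁ hu₁ u₂ hu₂ t₁ ht₁ t₂ ht₂ s₂' hs₂ s₁' hs₁ rel
    exact ⟨hs.symm, ht, hu⟩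
  rcases hc2 with hb | h2u
  · have hb' : IsC (t' * t₂⁻¹) := by
      have := isC_inv hb; rwa [show (t₂ * t'⁻¹)⁻¹ = t' * t₂⁻¹ by group] at this
    apply caseB
    rw [mul_assoc (t₁ * t'⁻¹), hb' (u₁ * u₂⁻¹)]
  · have hc : IsC (u₁ * u₂⁻¹) := by
      have := isC_mul h1u (isC_inv h2u)
      rwa [show u₁ * u'⁻¹ * (u₂ * u'⁻¹)⁻¹ = u₁ * u₂⁻¹ by group] at this
    apply caseB
    rw [mul_assoc (t₁ * t'⁻¹), ← hc (t' * t₂⁻¹)]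

/-- Lemma A: in a collision some quotient is central. [folklore] -/
theorem central_quotient (hTPP : TripleProductProperty S T U)
    (hK4 : ∀ a b c : G, a * b * c = z → IsC a ∨ IsC b ∨ IsC c ∨ a * b * a⁻¹ * b⁻¹ = z)
    {s s' t t' u u' : G} (hs : s ∈ S) (hs' : s' ∈ S) (ht : t ∈ T) (ht' : t' ∈ T)
    (hu : u ∈ U) (hu' : u' ∈ U) (h : s * s'⁻¹ * (t * t'⁻¹) * (u * u'⁻¹) = z) :
    IsC (s * s'⁻¹) ∨ IsC (t * t'⁻¹) ∨ IsC (u * u'⁻¹) := by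
  rcases hK4 _ _ _ h with h1 | h2 | h3 | h4
  · exact Or.inl h1
  · exact Or.inr (Or.inl h2)
  · exact Or.inr (Or.inr h3)
  · have rel : t * t'⁻¹ * (s * s'⁻¹) * (u * u'⁻¹) = 1 := by
      calc t * t'⁻¹ * (s * s'⁻¹) * (u * u'⁻¹)
          = (s * s'⁻¹ * (t * t'⁻¹) * (s * s'⁻¹)⁻¹ * (t * t'⁻¹)⁻¹)⁻¹
              * (s * s'⁻¹ * (t * t'⁻¹) * (u * u'⁻¹)) := by group
        _ = 1 := by rw [h4, h]; group
    obtain ⟨-, hss, -⟩ := tpp_swap12 hTPP t ht t' ht' s hs s' hs' u hu u' hu' rel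
    left; rw [hss, mul_inv_cancel]; exact isC_one

end Inj

/-! ### Bookkeeping objects for the counting (used in `K4Bound.lean`) -/

section CountDefs
variable [Fintype G] [DecidableEq G] {z : G} {S T U : Finset G}

/-- centrality is decidable in a finite group with decidable equality. [folklore] -/
instance decIsC (g : G) : Decidable (IsC g) := by unfold IsC; infer_instance

/-- TPP word of a pair of points `p = (s,t,u)`, `q = (s',t',u')`. [folklore] -/
def wd (p q : G × G × G) : G := p.1 * q.1⁻¹ * (p.2.1 * q.2.1⁻¹) * (p.2.2 * q.2.2⁻¹)

/-- plain product `s t u` of a point. [folklore] -/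
def pr (p : G × G × G) : G := p.1 * p.2.1 * p.2.2

/-- the points `S × T × U`. [folklore] -/
def Pts (S T U : Finset G) : Finset (G × G × G) := S ×ˢ (T ×ˢ U)

/-- collision predicate: the TPP word equals `z`. [folklore] -/
def IsColl (z : G) (pp : (G × G × G) × (G × G × G)) : Prop := wd pp.1 pp.2 = z

/-- the collision predicate is decidable. [folklore] -/
instance decIsColl (z : G) (pp : (G × G × G) × (G × G × G)) : Decidable (IsColl z pp) := by
  unfold IsColl; infer_instance

/-- the collisions `Ω`. [folklore] -/
def Coll (z : G) (S T U : Finset G) : Finset ((G × G × G) × (G × G × G)) :=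
  (Pts S T U ×ˢ Pts S T U).filter (IsColl z)

/-- "S- or T-quotient central", "S- or U-", "T- or U-". [folklore] -/
def C12 (pp : (G × G × G) × (G × G × G)) : Prop := IsC (pp.1.1 * pp.2.1⁻¹) ∨ IsC (pp.1.2.1 * pp.2.2.1⁻¹)
/-- "S- or U-quotient central". [folklore] -/
def C13 (pp : (G × G × G) × (G × G × G)) : Prop := IsC (pp.1.1 * pp.2.1⁻¹) ∨ IsC (pp.1.2.2 * pp.2.2.2⁻¹)
/-- "T- or U-quotient central". [folklore] -/
def C23 (pp : (G × G × G) × (G × G × G)) : Prop := IsC (pp.1.2.1 * pp.2.2.1⁻¹) ∨ IsC (pp.1.2.2 * pp.2.2.2⁻¹)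

/-- decidability of `C12`. [folklore] -/
instance decC12 (pp : (G × G × G) × (G × G × G)) : Decidable (C12 pp) := by unfold C12; infer_instance
/-- decidability of `C13`. [folklore] -/
instance decC13 (pp : (G × G × G) × (G × G × G)) : Decidable (C13 pp) := by unfold C13; infer_instance
/-- decidability of `C23`. [folklore] -/
instance decC23 (pp : (G × G × G) × (G × G × G)) : Decidable (C23 pp) := by unfold C23; infer_instance

/-- `g ∈ {stu, stu·z}` [folklore] -/
def Fib (z g : G) (p : G × G × G) : Prop := pr p = g ∨ pr p * z = g
/-- both points of a pair lie in the fibre of `g`. [folklore] -/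
def Fib2 (z g : G) (pp : (G × G × G) × (G × G × G)) : Prop := Fib z g pp.1 ∧ Fib z g pp.2
/-- `s't'u' ∈ {stu, stu·z}` [folklore] -/
def Rel (z : G) (pp : (G × G × G) × (G × G × G)) : Prop := pr pp.2 = pr pp.1 ∨ pr pp.2 = pr pp.1 * z

/-- decidability of `Fib`. [folklore] -/
instance decFib (z g : G) (p : G × G × G) : Decidable (Fib z g p) := by unfold Fib; infer_instance
/-- decidability of `Fib2`. [folklore] -/
instance decFib2 (z g : G) (pp : (G × G × G) × (G × G × G)) : Decidable (Fib2 z g pp) := by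
  unfold Fib2; infer_instance
/-- decidability of `Rel`. [folklore] -/
instance decRel (z : G) (pp : (G × G × G) × (G × G × G)) : Decidable (Rel z pp) := by
  unfold Rel; infer_instance

omit [Group G] [Fintype G] [DecidableEq G] in
/-- membership in `Pts S T U`. [folklore] -/
theorem mem_Pts {p : G × G × G} : p ∈ Pts S T U ↔ p.1 ∈ S ∧ p.2.1 ∈ T ∧ p.2.2 ∈ U := by
  unfold Pts; rw [Finset.mem_product, Finset.mem_product]

omit [Group G] [Fintype G] [DecidableEq G] in
/-- `|Pts S T U| = |S||T||U|`. [folklore] -/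
theorem card_Pts : (Pts S T U).card = S.card * T.card * U.card := by
  unfold Pts; rw [Finset.card_product, Finset.card_product, mul_assoc]

omit [Fintype G] in
/-- membership in the collision set `Coll z S T U`. [folklore] -/
theorem mem_Coll {pp : (G × G × G) × (G × G × G)} :
    pp ∈ Coll z S T U ↔ (pp.1 ∈ Pts S T U ∧ pp.2 ∈ Pts S T U) ∧ wd pp.1 pp.2 = z := by
  unfold Coll IsColl; rw [Finset.mem_filter, Finset.mem_product]


end CountDefs

end Summit.MatrixMultiplication.OmegaCensus.K4Bound
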